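import Summits.HubbardSuperconductivity.HubbardSuperconductivity.Theses.DeformationLadder
import Summits.HubbardSuperconductivity.HubbardSuperconductivity.Theorems.ThermalWedgeTwSeededEnsembleEquivalenceT0AHM
import Literature.MathematicalPhysics.QuantumLattice.DWaveSourceProofs

/-!
# Route `DeformationLadder`, item `ApproximatingHamiltonianGC` (stmt-HubbardSuperconductivity-1895):
# the zero-temperature approximating-Hamiltonian formula, GIVEN the source energy densities converge

Support file (`--supports stmt-HubbardSuperconductivity-1895`). Write `V = (L+1)²`,
`s_L(h) = E₀(dWaveSourceTorus (L+1) U μ h)/V` (the `d`-wave SOURCE energy densities) and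
`d_L = E₀(hubbardTorusWith 2 (L+1) 1 U μ − (g/V)·Δ_dᴴΔ_d)/V` (the DEFORMED energy density).

* `ahgc_groundEnergy_le_add_norm`: `E₀(B) ≤ E₀(A) + ‖B − A‖` for Hermitian matrices;
* `ahgc_source_lipschitz`: `|s_L(h) − s_L(h')| ≤ K|h − h'|` with the `L`-independent constant
  `K = 2·(2 Σ_e |d(e)/√2|)` (`‖Δ_d‖ ≤ (2Σ_e|d(e)/√2|)·L²`, `norm_pairField_le`);
* `approximatingHamiltonianGC_of_sourceLimit`: IF for every `U ≥ 0`, `μ`, `h` the source densities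
  `s_L(h)` converge, THEN `ApproximatingHamiltonianGC` holds: `d_L → ⨅_{h ≥ 0} (e(h) + h²/g)`.
  Proof: the tree's finite-volume `T = 0` Bogoliubov Jr. bound `stub_t0AHM` (both halves:
  `d_L ≤ s_L(h) + h²/g` for all `h`, and `∀ ε ∃ L₀ ∀ L ≥ L₀ ∃ h_L ≥ 0, s_L(h_L) + h_L²/g ≤ d_L + ε`),
  the a-priori bound `h_L ≤ gK + gε + 1` (from `s_L(h_L) ≥ s_L(0) − K h_L` and `d_L ≤ s_L(0)`),
  and UNIFORM convergence `s_L → e` on `[0, H]` (equi-Lipschitz family converging pointwise: a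
  finite grid of mesh `δ` with `Kδ` small). The infimum over `{h // 0 ≤ h}` is an honest one:
  `e(h) + h²/g ≥ e(0) − Kh + h²/g` is bounded below.

Bogolyubov Jr. (1966); Bru–de Siqueira Pedra, Mem. AMS 224 (2013), Thm 107; the `β → ∞`,
`L → ∞` bookkeeping is folklore. No definitions are introduced.
-/

set_option linter.dupNamespace false

noncomputable section

namespace Summit.HubbardSuperconductivity.HubbardSuperconductivity.Theorems

open Matrix Filter Topology Literature.MathematicalPhysics.QuantumLattice
open Literature.Probability.LatticeModels
open Summit.HubbardSuperconductivity.HubbardSuperconductivity.Theorems.TwSeededEnsembleEquivalence.ExposedDensity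
open scoped ComplexOrder Matrix.Norms.L2Operator

/-- **The ground energy is `1`-Lipschitz in the operator norm**: `E₀(B) ≤ E₀(A) + ‖B − A‖` for
Hermitian `A, B` (the tracial ground state of `A` is a trial state for `B`, and
`|Re ω_A(B − A)| ≤ ‖B − A‖`). [folklore] -/
theorem ahgc_groundEnergy_le_add_norm {n : Type*} [Fintype n] [DecidableEq n] [Nonempty n]
    {A B : Matrix n n ℂ} (hA : A.IsHermitian) (hB : B.IsHermitian) :
    B.groundEnergy ≤ A.groundEnergy + ‖B - A‖ := by
  have h1 := groundEnergy_le_groundStateFunctional_re hA hB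
  have h2 : A.groundStateFunctional B = A.groundStateFunctional A + A.groundStateFunctional (B - A) := by
    rw [map_sub]; ring
  rw [h2, groundStateFunctional_hamiltonian hA, Complex.add_re, Complex.ofReal_re] at h1
  have h3 := abs_re_groundStateFunctional_le_norm hA (B - A)
  linarith [le_abs_self ((A.groundStateFunctional (B - A)).re)]

/-- Two-sided form: `|E₀(A) − E₀(B)| ≤ ‖A − B‖` for Hermitian `A, B`. [folklore] -/
theorem ahgc_abs_groundEnergy_sub_le_norm {n : Type*} [Fintype n] [DecidableEq n] [Nonempty n]
    {A B : Matrix n n ℂ} (hA : A.IsHermitian) (hB : B.IsHermitian) :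
    |A.groundEnergy - B.groundEnergy| ≤ ‖A - B‖ := by
  have h1 := ahgc_groundEnergy_le_add_norm hA hB
  have h2 := ahgc_groundEnergy_le_add_norm hB hA
  rw [← norm_neg, neg_sub] at h1
  rw [abs_le]
  constructor <;> linarith

/-- **The source energies are Lipschitz in the source strength**, uniformly in the volume:
`|E₀(H_{L,h}) − E₀(H_{L,h'})| ≤ |h − h'| · 2(2Σ_e|d(e)/√2|) · L²`
(`H_{L,h} − H_{L,h'} = −(h − h')(Δ_d + Δ_dᴴ)` and `‖Δ_d‖ ≤ (2Σ_e|d(e)/√2|)L²`). [folklore] -/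
theorem ahgc_source_lipschitz (L : ℕ) [NeZero L] (U μ h h' : ℝ) :
    |(dWaveSourceTorus L U μ h).groundEnergy - (dWaveSourceTorus L U μ h').groundEnergy| ≤
      |h - h'| * (2 * ((2 * ∑ e ∈ insert (0 : Site 2) unitSteps,
        |dWaveFormFactor e / Real.sqrt 2|) * (L : ℝ) ^ 2)) := by
  have hT : (hubbardTorusWith 2 L 1 U μ).IsHermitian := isHermitian_hubbardTorusWith L 1 U μ
  have hS := dWaveSourceTorus_isHermitian L hT h
  have hS' := dWaveSourceTorus_isHermitian L hT h'
  refine (ahgc_abs_groundEnergy_sub_le_norm hS hS').trans ?_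
  have hdiff : dWaveSourceTorus L U μ h - dWaveSourceTorus L U μ h' =
      (((h' - h : ℝ)) : ℂ) • (pairField dWaveFormFactor L + (pairField dWaveFormFactor L)ᴴ) := by
    rw [dWaveSourceTorus_eq, dWaveSourceTorus_eq, Complex.ofReal_sub, sub_smul]
    abel
  rw [hdiff, twAhm_norm_real_smul, abs_sub_comm h' h]
  refine mul_le_mul_of_nonneg_left ?_ (abs_nonneg _)
  calc ‖pairField dWaveFormFactor L + (pairField dWaveFormFactor L)ᴴ‖
      ≤ ‖pairField dWaveFormFactor L‖ + ‖(pairField dWaveFormFactor L)ᴴ‖ := norm_add_le _ _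
    _ = 2 * ‖pairField dWaveFormFactor L‖ := by rw [l2_opNorm_conjTranspose]; ring
    _ ≤ 2 * ((2 * ∑ e ∈ insert (0 : Site 2) unitSteps, |dWaveFormFactor e / Real.sqrt 2|) *
          (L : ℝ) ^ 2) := mul_le_mul_of_nonneg_left (norm_pairField_le dWaveFormFactor L) (by norm_num)

/-- **Uniform convergence of an equi-Lipschitz family on a compact interval from pointwise
convergence** (the Arzelà–Ascoli step, in the elementary grid form): if `|f L x − f L y| ≤ K|x − y|`
for all `L`, `f L x → φ x` for every `x`, and `0 ≤ K`, then for every `H` and `ε > 0` there is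
`L₀` with `|f L x − φ x| ≤ ε` for all `L ≥ L₀` and `x ∈ [0, H]`. [folklore] -/
theorem ahgc_uniform_of_pointwise {f : ℕ → ℝ → ℝ} {φ : ℝ → ℝ} {K : ℝ} (hK : 0 ≤ K)
    (hLip : ∀ L x y, |f L x - f L y| ≤ K * |x - y|)
    (hlim : ∀ x, Tendsto (fun L => f L x) atTop (𝓝 (φ x))) (H : ℝ) {ε : ℝ} (hε : 0 < ε) :
    ∃ L₀ : ℕ, ∀ L, L₀ ≤ L → ∀ x ∈ Set.Icc (0 : ℝ) H, |f L x - φ x| ≤ ε := by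
  -- the limit is `K`-Lipschitz as well
  have hLipφ : ∀ x y, |φ x - φ y| ≤ K * |x - y| := by
    intro x y
    have h1 : Tendsto (fun L => |f L x - f L y|) atTop (𝓝 |φ x - φ y|) :=
      ((hlim x).sub (hlim y)).abs
    exact le_of_tendsto' h1 fun L => hLip L x y
  -- mesh `δ` with `K δ ≤ ε/3`
  obtain ⟨δ, hδ0, hδ⟩ : ∃ δ : ℝ, 0 < δ ∧ K * δ ≤ ε / 3 := by
    refine ⟨ε / (3 * (K + 1)), by positivity, ?_⟩
    rw [show K * (ε / (3 * (K + 1))) = ε / 3 * (K / (K + 1)) by field_simp]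
    have h1 : K / (K + 1) ≤ 1 := (div_le_one (by linarith)).2 (by linarith)
    calc ε / 3 * (K / (K + 1)) ≤ ε / 3 * 1 := mul_le_mul_of_nonneg_left h1 (by positivity)
      _ = ε / 3 := mul_one _
  -- finitely many grid points `j δ`, `j ≤ J`
  set J : ℕ := ⌈H / δ⌉₊ with hJ
  have hpt : ∀ j : ℕ, ∃ N : ℕ, ∀ L, N ≤ L → |f L (j * δ) - φ (j * δ)| < ε / 3 := by
    intro j
    have h := Metric.tendsto_atTop.mp (hlim (j * δ)) (ε / 3) (by positivity)
    obtain ⟨N, hN⟩ := h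
    exact ⟨N, fun L hL => by simpa [Real.dist_eq] using hN L hL⟩
  choose N hN using hpt
  refine ⟨(Finset.range (J + 1)).sup N, fun L hL x hx => ?_⟩
  obtain ⟨hx0, hxH⟩ := hx
  -- the grid point below `x`
  set j : ℕ := ⌊x / δ⌋₊ with hj
  have hjx : (j : ℝ) * δ ≤ x := by
    have := Nat.floor_le (div_nonneg hx0 hδ0.le)
    rw [← hj] at this
    rwa [le_div_iff₀ hδ0] at this
  have hxj : x < (j : ℝ) * δ + δ := by
    have := Nat.lt_floor_add_one (x / δ)
    rw [← hj, div_lt_iff₀ hδ0] at this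
    linarith
  have hjJ : j ≤ J := by
    rw [hj, hJ]
    exact (Nat.floor_le_floor (div_le_div_of_nonneg_right hxH hδ0.le)).trans (Nat.floor_le_ceil _)
  have hNj : N j ≤ L :=
    (Finset.le_sup (f := N) (Finset.mem_range.2 (Nat.lt_succ_of_le hjJ))).trans hL
  have h1 := hLip L x (j * δ)
  have h2 := hN j L hNj
  have h3 := hLipφ (j * δ) x
  have hdist : |x - j * δ| ≤ δ := by
    rw [abs_le]; constructor <;> linarith
  have hdist' : |(j : ℝ) * δ - x| ≤ δ := by rw [abs_sub_comm]; exact hdist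
  have e1 : f L x - φ x = (f L x - f L (j * δ)) + (f L (j * δ) - φ (j * δ)) + (φ (j * δ) - φ x) := by
    ring
  rw [e1]
  have hA := abs_add_le (f L x - f L (j * δ) + (f L (j * δ) - φ (j * δ))) (φ (j * δ) - φ x)
  have hB := abs_add_le (f L x - f L (j * δ)) (f L (j * δ) - φ (j * δ))
  have h1' : |f L x - f L (j * δ)| ≤ ε / 3 :=
    h1.trans ((mul_le_mul_of_nonneg_left hdist hK).trans hδ)
  have h3' : |φ (j * δ) - φ x| ≤ ε / 3 :=
    h3.trans ((mul_le_mul_of_nonneg_left hdist' hK).trans hδ)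
  linarith [h2.le]

/-- **`ApproximatingHamiltonianGC` from convergence of the source energy densities.** If for every
`U ≥ 0`, `μ` and real `h` the `d`-wave source energy densities
`E₀(dWaveSourceTorus (L+1) U μ h)/(L+1)²` converge as `L → ∞`, then the zero-temperature
approximating-Hamiltonian formula holds on the tori: with `e(h)` the limits,
`E₀(hubbardTorusWith 2 (L+1) 1 U μ − (g/(L+1)²)Δ_dᴴΔ_d)/(L+1)² → ⨅_{h ≥ 0} (e(h) + h²/g)` for every
`g > 0`. The finite-volume input is the tree's `T = 0` Bogoliubov Jr. bound `stub_t0AHM` (both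
halves); the passage to the limit uses the volume-uniform Lipschitz bound `ahgc_source_lipschitz`
(coercivity: the near-minimisers `h_L` stay in a fixed compact `[0, H]`, and the convergence is
uniform there). Bogolyubov Jr. (1966); Bru–de Siqueira Pedra (2013), Thm 107. -/
theorem approximatingHamiltonianGC_of_sourceLimit
    (hsrc : ∀ (U μ h : ℝ), 0 ≤ U → ∃ e : ℝ, Tendsto (fun L : ℕ =>
      (dWaveSourceTorus (L + 1) U μ h).groundEnergy / ((L + 1 : ℕ) : ℝ) ^ 2) atTop (𝓝 e)) :
    Summit.HubbardSuperconductivity.HubbardSuperconductivity.Theses.DeformationLadder.ApproximatingHamiltonianGC := by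
  intro U μ g hU hg
  choose e he using fun h => hsrc U μ h hU
  refine ⟨e, fun h _ => he h, ?_⟩
  -- notation: volumes, source densities, deformed densities
  set V : ℕ → ℝ := fun L => ((L + 1 : ℕ) : ℝ) ^ 2 with hV
  have hVpos : ∀ L, 0 < V L := fun L => by rw [hV]; positivity
  set s : ℕ → ℝ → ℝ := fun L h => (dWaveSourceTorus (L + 1) U μ h).groundEnergy / V L with hs
  set d : ℕ → ℝ := fun L => (hubbardTorusWith 2 (L + 1) 1 U μ -
      ((g / ((L + 1 : ℕ) : ℝ) ^ 2 : ℝ) : ℂ) • ((pairField dWaveFormFactor (L + 1))ᴴ *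
        pairField dWaveFormFactor (L + 1))).groundEnergy / V L with hd
  have hes : ∀ h, Tendsto (fun L => s L h) atTop (𝓝 (e h)) := fun h => he h
  -- the Lipschitz constant
  obtain ⟨K, hKdef⟩ : ∃ K : ℝ, K = 2 * (2 * ∑ e ∈ insert (0 : Site 2) unitSteps,
      |dWaveFormFactor e / Real.sqrt 2|) := ⟨_, rfl⟩
  have hK0 : 0 ≤ K := by rw [hKdef]; positivity
  have hLip : ∀ L x y, |s L x - s L y| ≤ K * |x - y| := by
    intro L x y
    have h1 := ahgc_source_lipschitz (L + 1) U μ x y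
    simp only [hs]
    rw [← sub_div, abs_div, abs_of_pos (hVpos L), div_le_iff₀ (hVpos L)]
    calc _ ≤ _ := h1
      _ = K * |x - y| * V L := by rw [hKdef, hV]; push_cast; ring
  have hLipe : ∀ x y, |e x - e y| ≤ K * |x - y| := by
    intro x y
    have h1 : Tendsto (fun L => |s L x - s L y|) atTop (𝓝 |e x - e y|) :=
      ((hes x).sub (hes y)).abs
    exact le_of_tendsto' h1 fun L => hLip L x y
  -- the two halves of the finite-volume bound, in density form
  obtain ⟨heasy, hhard⟩ := stub_t0AHM U g |μ| hg
  have heasy' : ∀ L h, d L ≤ s L h + h ^ 2 / g := by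
    intro L h
    have h1 := heasy (L + 1) μ h
    simp only [hd, hs]
    have hVL : V L = ((L + 1 : ℕ) : ℝ) ^ 2 := rfl
    rw [div_add' _ _ _ (hVpos L).ne', div_le_div_iff_of_pos_right (hVpos L)]
    have : h ^ 2 / g * V L = h ^ 2 * ((L + 1 : ℕ) : ℝ) ^ 2 / g := by rw [hVL]; ring
    linarith
  -- the variational functional is bounded below on `h ≥ 0`
  have hlow : ∀ x : {h : ℝ // 0 ≤ h}, e 0 - K ^ 2 * g / 4 ≤ e x + (x : ℝ) ^ 2 / g := by
    rintro ⟨x, hx⟩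
    have h1 := hLipe x 0
    rw [sub_zero, abs_of_nonneg hx] at h1
    have h2 : e 0 - K * x ≤ e x := by linarith [neg_abs_le (e x - e 0)]
    have h3 : K * x ≤ x ^ 2 / g + K ^ 2 * g / 4 := by
      rw [div_add_div _ _ hg.ne' (by norm_num : (4 : ℝ) ≠ 0), le_div_iff₀ (by positivity)]
      nlinarith [sq_nonneg (2 * x - K * g)]
    dsimp only
    linarith
  have hbdd : BddBelow (Set.range fun x : {h : ℝ // 0 ≤ h} => e x + (x : ℝ) ^ 2 / g) := by
    refine ⟨e 0 - K ^ 2 * g / 4, ?_⟩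
    rintro _ ⟨x, rfl⟩
    exact hlow x
  haveI : Nonempty {h : ℝ // 0 ≤ h} := ⟨⟨0, le_rfl⟩⟩
  set I : ℝ := ⨅ x : {h : ℝ // 0 ≤ h}, e x + (x : ℝ) ^ 2 / g with hI
  have hIle : ∀ x : ℝ, 0 ≤ x → I ≤ e x + x ^ 2 / g := fun x hx =>
    ciInf_le hbdd ⟨x, hx⟩
  -- ε-management
  rw [Metric.tendsto_atTop]
  intro ε hε
  -- UPPER bound: a near-minimiser `x₀` and pointwise convergence at `x₀`
  obtain ⟨⟨x₀, hx₀⟩, hx₀I⟩ : ∃ x : {h : ℝ // 0 ≤ h}, e x + (x : ℝ) ^ 2 / g < I + ε / 2 :=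
    exists_lt_of_ciInf_lt (by linarith)
  obtain ⟨L₁, hL₁⟩ : ∃ L₁ : ℕ, ∀ L, L₁ ≤ L → |s L x₀ - e x₀| < ε / 2 := by
    obtain ⟨N, hN⟩ := Metric.tendsto_atTop.mp (hes x₀) (ε / 2) (by positivity)
    exact ⟨N, fun L hL => by simpa [Real.dist_eq] using hN L hL⟩
  -- LOWER bound: the hard half at accuracy `ε/3`
  obtain ⟨L₀, hL₀⟩ := hhard (ε / 3) (by positivity)
  -- a priori bound on the near-minimisers
  obtain ⟨H, hHdef⟩ : ∃ H : ℝ, H = g * K + g * ε + 1 := ⟨_, rfl⟩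
  -- uniform convergence on `[0, H]` at accuracy `ε/3`
  obtain ⟨L₂, hL₂⟩ := ahgc_uniform_of_pointwise hK0 hLip hes H (show 0 < ε / 3 by positivity)
  refine ⟨max L₀ (max L₁ L₂), fun L hL => ?_⟩
  have hL0 : L₀ ≤ L + 1 := ((le_max_left _ _).trans hL).trans (Nat.le_succ L)
  have hL1 : L₁ ≤ L := ((le_max_left _ _).trans (le_max_right _ _)).trans hL
  have hL2 : L₂ ≤ L := ((le_max_right _ _).trans (le_max_right _ _)).trans hL
  rw [Real.dist_eq, abs_lt]
  constructor
  · -- lower: `I - ε < d L`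
    obtain ⟨hL, hhL0, hhard'⟩ := hL₀ (L + 1) hL0 μ le_rfl
    have hbound : s L hL + hL ^ 2 / g ≤ d L + ε / 3 := by
      simp only [hd, hs]
      have hVL : V L = ((L + 1 : ℕ) : ℝ) ^ 2 := rfl
      rw [div_add' _ _ _ (hVpos L).ne', div_add' _ _ _ (hVpos L).ne',
        div_le_div_iff_of_pos_right (hVpos L)]
      have e1 : hL ^ 2 / g * V L = hL ^ 2 * ((L + 1 : ℕ) : ℝ) ^ 2 / g := by rw [hVL]; ring
      have e2 : ε / 3 * V L = ε / 3 * ((L + 1 : ℕ) : ℝ) ^ 2 := by rw [hVL]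
      linarith
    -- `hL ≤ H`
    have hs0 : s L 0 - K * hL ≤ s L hL := by
      have h1 := hLip L hL 0
      rw [sub_zero, abs_of_nonneg hhL0] at h1
      linarith [neg_abs_le (s L hL - s L 0)]
    have hd0 : d L ≤ s L 0 := by have := heasy' L 0; simpa using this
    have hquad : hL ^ 2 / g ≤ K * hL + ε / 3 := by linarith
    have hquad' : hL ^ 2 ≤ g * K * hL + g * (ε / 3) := by
      rw [div_le_iff₀ hg] at hquad; linarith
    have hHle : hL ≤ H := by
      by_contra hcon
      have hcon : H < hL := lt_of_not_ge hcon
      have hgK : 0 ≤ g * K := mul_nonneg hg.le hK0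
      have hgε : 0 ≤ g * ε := mul_nonneg hg.le hε.le
      have h1 : 1 ≤ H := by rw [hHdef]; linarith
      have hLpos : 0 < hL := by linarith
      have h2 : hL * H < hL * hL := mul_lt_mul_of_pos_left hcon hLpos
      have h3 : hL * H = g * K * hL + (g * ε + 1) * hL := by rw [hHdef]; ring
      have h4 : (g * ε + 1) * H < (g * ε + 1) * hL := mul_lt_mul_of_pos_left hcon (by linarith)
      have h5 : (g * ε + 1) * 1 ≤ (g * ε + 1) * H := mul_le_mul_of_nonneg_left h1 (by linarith)
      nlinarith
    have hunif := hL₂ L hL2 hL ⟨hhL0, hHle⟩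
    have h1 : e hL ≤ s L hL + ε / 3 := by linarith [(abs_le.mp hunif).1]
    have h2 := hIle hL hhL0
    linarith
  · -- upper: `d L < I + ε`
    have h1 := heasy' L x₀
    have h2 := hL₁ L hL1
    have h3 : s L x₀ < e x₀ + ε / 2 := by linarith [(abs_lt.mp h2).2]
    linarith

end Summit.HubbardSuperconductivity.HubbardSuperconductivity.Theorems

end
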